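import Mathlib
import HarnessLib
import Literature.Probability.LatticeModels.LatticeGraph

/-!
# BalabanIR crux 2R `BirComplexStableXYR` (stmt-HubbardSuperconductivity-14845): the split glue
# `ComplexPositivity → ComplexTwoPointDeficit → BirComplexStableXYR`, stated STRUCTURALLY

Line `log-concave-core-bounded-phase` (line lead c1).  The line's proved ENDGAME, extracted from the crux
workfile `Cruxes/BirComplexStableXYR/Lines/log_concave_core_bounded_phase.lean` (leads a2/c1) into a
Theses-FREE module, so that a planner can split the crux into its two honest children (D-0019 glued split)
and the gate can cite this theorem as the glue without an import cycle (route BalabanIR MATERIALISATION RULE):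

* child 1 (`ComplexPositivity`, hypothesis `h1`): for every admissible (U1)(N)(A)(C)(R)(P) table,
  `K ≥ K₀(r,B,c₀)`, even `L₀ ≤ L ≤ M`: `0 < Re Z` and `Im Z = 0`;
* child 2 (`ComplexTwoPointDeficit`, hypothesis `h2`): same quantifiers, some `C`, all slice sites `x, y`:
  `Re ∫ (1 − cos(θ_{x,0} − θ_{y,0})) e^{−A} ≤ C/(c₀K) · Re Z`;
* conclusion: the crux `BalabanIR.BirComplexStableXYR` VERBATIM (body of Theses/BalabanIR.lean, rev 11).

Proof (`sg_core`, weight abstract): `|Σ_x e^{iθ_x}|²/L⁴ = 1 − L⁻⁴ Σ_{x,y}(1 − cos(θ_x − θ_y))`, so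
`Re ∫ O e^{−A} = Re Z − L⁻⁴ Σ_{x,y} Re ∫ (1 − cos)e^{−A} ≥ (1 − C/(c₀K)) Re Z`; with `Im Z = 0` and
`K ≥ 2C/c₀` this is `Re(∫ O e^{−A} / Z) ≥ 1/2`, and `Z ≠ 0` from `Re Z > 0`.  Thresholds:
`K₀ = max (max K₀¹ K₀²) (max (2C/c₀) 1)`, `L₀ = max L₀¹ L₀²`.  No statement of the route is restated as a
definition here (the three bodies appear only as hypothesis / conclusion types). [folklore]
-/

noncomputable section

namespace Summit.HubbardSuperconductivity.HubbardSuperconductivity.Theorems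

open scoped BigOperators ComplexConjugate
open MeasureTheory Literature.Probability.LatticeModels Complex

section SplitGlue

/-- `|Σ_x e^{iθ_x}|²/L⁴ = 1 − L⁻⁴ Σ_x Σ_y (1 − cos(θ_x − θ_y))` on the `L × L` slice. [folklore] -/
theorem sg_sliceObs_eq (L : ℕ) [NeZero L] (θs : TorusSite 2 L → ℝ) :
    ‖∑ x : TorusSite 2 L, cexp (I * (θs x : ℂ))‖ ^ 2 / (L : ℝ) ^ 4 =
      1 - (∑ x : TorusSite 2 L, ∑ y : TorusSite 2 L, (1 - Real.cos (θs x - θs y))) / (L : ℝ) ^ 4 := by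
  -- `|Σ_x e^{iθ_x}|² = Σ_x Σ_y cos(θ_x − θ_y)` (the landed `sw_norm_sq_sum_cexp` lives in a Theses-dependent module,
  -- so the computation is redone inline to keep this module Theses-free)
  have hns : ‖∑ x : TorusSite 2 L, cexp (I * (θs x : ℂ))‖ ^ 2 =
      ∑ x : TorusSite 2 L, ∑ y : TorusSite 2 L, Real.cos (θs x - θs y) := by
    set S : ℂ := ∑ x, cexp (I * (θs x : ℂ)) with hS
    have h1 : ((‖S‖ ^ 2 : ℝ) : ℂ) = S * conj S := by
      rw [Complex.mul_conj, Complex.normSq_eq_norm_sq]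
    have h2 : S * conj S = ∑ x, ∑ y, cexp (I * (θs x : ℂ)) * conj (cexp (I * (θs y : ℂ))) := by
      rw [hS, map_sum, Finset.sum_mul_sum]
    have h3 : ∀ x y, cexp (I * (θs x : ℂ)) * conj (cexp (I * (θs y : ℂ))) =
        cexp (((θs x - θs y : ℝ) : ℂ) * I) := by
      intro x y
      rw [← Complex.exp_conj, map_mul, Complex.conj_I, Complex.conj_ofReal, ← Complex.exp_add]
      congr 1
      push_cast
      ring
    have h4 : ‖S‖ ^ 2 = (S * conj S).re := by rw [← h1, Complex.ofReal_re]
    rw [h4, h2, Complex.re_sum]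
    refine Finset.sum_congr rfl fun x _ => ?_
    rw [Complex.re_sum]
    refine Finset.sum_congr rfl fun y _ => ?_
    rw [h3, Complex.exp_ofReal_mul_I_re]
  rw [hns]
  have hcard : (Fintype.card (TorusSite 2 L) : ℝ) = (L : ℝ) ^ 2 := by
    simp [TorusSite, ZMod.card]
  have hL : (L : ℝ) ≠ 0 := by exact_mod_cast (NeZero.ne L)
  have hsum : ∑ x : TorusSite 2 L, ∑ y : TorusSite 2 L, (1 - Real.cos (θs x - θs y)) =
      (L : ℝ) ^ 4 - ∑ x : TorusSite 2 L, ∑ y : TorusSite 2 L, Real.cos (θs x - θs y) := by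
    simp only [Finset.sum_sub_distrib, Finset.sum_const, Finset.card_univ, nsmul_eq_mul, hcard]
    ring
  rw [hsum]
  field_simp
  ring

/-- The cube `[0,2π]^Λ` has finite Lebesgue measure. [folklore] -/
theorem sg_isFiniteMeasure_cube (Λ : Type*) [Fintype Λ] :
    IsFiniteMeasure ((volume : Measure (Λ → ℝ)).restrict
      (Set.pi Set.univ (fun _ : Λ => Set.Icc (0:ℝ) (2 * Real.pi)))) := by
  refine ⟨?_⟩
  rw [Measure.restrict_apply_univ, volume_pi, Measure.pi_pi]
  simp only [Real.volume_Icc, sub_zero, Finset.prod_const, Finset.card_univ]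
  exact ENNReal.pow_lt_top ENNReal.ofReal_lt_top

/-- Integrability on the cube of a bounded continuous function times a continuous weight of modulus `≤ 1`.
[folklore] -/
theorem sg_integrable_mul_weight {Λ : Type*} [Fintype Λ] (wt : (Λ → ℝ) → ℂ) (hwc : Continuous wt)
    (hwb : ∀ θ, ‖wt θ‖ ≤ 1) (g : (Λ → ℝ) → ℂ) (hg : Continuous g) (Cg : ℝ) (hgb : ∀ θ, ‖g θ‖ ≤ Cg) :
    Integrable (fun θ => g θ * wt θ)
      ((volume : Measure (Λ → ℝ)).restrict (Set.pi Set.univ (fun _ : Λ => Set.Icc (0:ℝ) (2 * Real.pi)))) := by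
  haveI := sg_isFiniteMeasure_cube Λ
  refine (integrable_const (max Cg 0)).mono' (hg.mul hwc).aestronglyMeasurable (ae_of_all _ fun θ => ?_)
  rw [norm_mul]
  calc ‖g θ‖ * ‖wt θ‖ ≤ Cg * 1 :=
        mul_le_mul (hgb θ) (hwb θ) (norm_nonneg _) ((norm_nonneg _).trans (hgb θ))
    _ ≤ max Cg 0 := by simp

/-- **Core of the glue (weight abstract).**  For a continuous weight `wt` of modulus `≤ 1` on the cube with
`Z := ∫ wt`, `0 < Re Z`, `Im Z = 0`, and the two-point bounds `Re ∫ (1 − cos(θ_{x,0} − θ_{y,0}))·wt ≤ κ·Re Z`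
for all slice sites with `κ ≤ 1/2`: `Z ≠ 0` and `Re(∫ O·wt / Z) ≥ 1/2` for the slice-order observable
`O = |Σ_x e^{iθ_{x,0}}|²/L⁴`. [folklore] -/
theorem sg_core (L M : ℕ) [NeZero L] [NeZero M] (wt : ((TorusSite 2 L × ZMod M) → ℝ) → ℂ)
    (hwc : Continuous wt) (hwb : ∀ θ, ‖wt θ‖ ≤ 1) {κ : ℝ} (hκ : κ ≤ 1 / 2)
    (hZpos : 0 < (∫ θ in Set.pi Set.univ (fun _ => Set.Icc (0:ℝ) (2 * Real.pi)), wt θ).re)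
    (hZim : (∫ θ in Set.pi Set.univ (fun _ => Set.Icc (0:ℝ) (2 * Real.pi)), wt θ).im = 0)
    (hdef : ∀ x y : TorusSite 2 L, (∫ θ in Set.pi Set.univ (fun _ => Set.Icc (0:ℝ) (2 * Real.pi)),
        (((1 - Real.cos (θ (x, 0) - θ (y, 0)) : ℝ)) : ℂ) * wt θ).re ≤
        κ * (∫ θ in Set.pi Set.univ (fun _ => Set.Icc (0:ℝ) (2 * Real.pi)), wt θ).re) :
    (∫ θ in Set.pi Set.univ (fun _ => Set.Icc (0:ℝ) (2 * Real.pi)), wt θ) ≠ 0 ∧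
    (1/2 : ℝ) ≤ ((∫ θ in Set.pi Set.univ (fun _ => Set.Icc (0:ℝ) (2 * Real.pi)),
        ((‖∑ x : TorusSite 2 L, cexp (I * (θ (x, 0) : ℂ))‖ ^ 2 / (L : ℝ) ^ 4 : ℝ) : ℂ) * wt θ) /
      (∫ θ in Set.pi Set.univ (fun _ => Set.Icc (0:ℝ) (2 * Real.pi)), wt θ)).re := by
  set cube : Set ((TorusSite 2 L × ZMod M) → ℝ) := Set.pi Set.univ (fun _ => Set.Icc (0:ℝ) (2 * Real.pi))
    with hcube
  set Z : ℂ := ∫ θ in cube, wt θ with hZ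
  set D : TorusSite 2 L → TorusSite 2 L → ((TorusSite 2 L × ZMod M) → ℝ) → ℝ :=
    fun x y θ => 1 - Real.cos (θ (x, 0) - θ (y, 0)) with hD
  -- integrability
  have hint1 : Integrable (fun θ => (1 : ℂ) * wt θ) (volume.restrict cube) :=
    sg_integrable_mul_weight wt hwc hwb (fun _ => (1 : ℂ)) continuous_const 1 (fun _ => by simp)
  have hint0 : Integrable wt (volume.restrict cube) := by simpa using hint1
  have hintD : ∀ x y, Integrable (fun θ => ((D x y θ : ℝ) : ℂ) * wt θ) (volume.restrict cube) := by
    intro x y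
    refine sg_integrable_mul_weight wt hwc hwb _ ?_ 2 (fun θ => ?_)
    · exact Complex.continuous_ofReal.comp (continuous_const.sub
        (Real.continuous_cos.comp ((continuous_apply _).sub (continuous_apply _))))
    · rw [Complex.norm_real, Real.norm_eq_abs, abs_le]
      constructor <;> nlinarith [Real.cos_le_one (θ (x, 0) - θ (y, 0)), Real.neg_one_le_cos (θ (x, 0) - θ (y, 0))]
  -- the numerator identity
  have hnum : ∫ θ in cube, (((‖∑ x : TorusSite 2 L, cexp (I * (θ (x, 0) : ℂ))‖ ^ 2 /
        (L : ℝ) ^ 4 : ℝ)) : ℂ) * wt θ =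
      Z - (1 / (L : ℂ) ^ 4) *
        ∑ x : TorusSite 2 L, ∑ y : TorusSite 2 L, ∫ θ in cube, ((D x y θ : ℝ) : ℂ) * wt θ := by
    have hpt : ∀ θ : (TorusSite 2 L × ZMod M) → ℝ,
        (((‖∑ x : TorusSite 2 L, cexp (I * (θ (x, 0) : ℂ))‖ ^ 2 / (L : ℝ) ^ 4 : ℝ)) : ℂ) * wt θ =
        wt θ - (1 / (L : ℂ) ^ 4) * ∑ x : TorusSite 2 L, ∑ y : TorusSite 2 L,
          ((D x y θ : ℝ) : ℂ) * wt θ := by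
      intro θ
      rw [sg_sliceObs_eq L (fun x => θ (x, 0))]
      simp only [hD]
      push_cast
      simp only [← Finset.sum_mul]
      ring
    simp_rw [hpt]
    have hintS : Integrable (fun θ => ∑ x : TorusSite 2 L, ∑ y : TorusSite 2 L,
        ((D x y θ : ℝ) : ℂ) * wt θ) (volume.restrict cube) :=
      integrable_finsetSum _ fun x _ => integrable_finsetSum _ fun y _ => hintD x y
    rw [integral_sub hint0 (hintS.const_mul _), integral_const_mul (1 / (L : ℂ) ^ 4),
      integral_finsetSum _ (fun x _ => integrable_finsetSum _ fun y _ => hintD x y)]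
    congr 2
    exact Finset.sum_congr rfl fun x _ => integral_finsetSum _ fun y _ => hintD x y
  -- real parts
  have hcard : (Fintype.card (TorusSite 2 L) : ℝ) = (L : ℝ) ^ 2 := by simp [TorusSite, ZMod.card]
  have hL : (0 : ℝ) < L := by exact_mod_cast Nat.pos_of_ne_zero (NeZero.ne L)
  have hsumre : (∑ x : TorusSite 2 L, ∑ y : TorusSite 2 L,
      ∫ θ in cube, ((D x y θ : ℝ) : ℂ) * wt θ).re ≤ (L : ℝ) ^ 4 * (κ * Z.re) := by
    rw [Complex.re_sum]
    calc ∑ x : TorusSite 2 L, (∑ y : TorusSite 2 L, ∫ θ in cube, ((D x y θ : ℝ) : ℂ) * wt θ).re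
        ≤ ∑ _x : TorusSite 2 L, ∑ _y : TorusSite 2 L, κ * Z.re := by
          refine Finset.sum_le_sum fun x _ => ?_
          rw [Complex.re_sum]
          exact Finset.sum_le_sum fun y _ => hdef x y
      _ = (L : ℝ) ^ 4 * (κ * Z.re) := by
          simp only [Finset.sum_const, Finset.card_univ, nsmul_eq_mul, hcard]
          ring
  have hre_main : (1 - κ) * Z.re ≤
      (∫ θ in cube, (((‖∑ x : TorusSite 2 L, cexp (I * (θ (x, 0) : ℂ))‖ ^ 2 /
        (L : ℝ) ^ 4 : ℝ)) : ℂ) * wt θ).re := by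
    rw [hnum, Complex.sub_re]
    have h4 : ((1 / (L : ℂ) ^ 4) * ∑ x : TorusSite 2 L, ∑ y : TorusSite 2 L,
        ∫ θ in cube, ((D x y θ : ℝ) : ℂ) * wt θ).re =
        (1 / (L : ℝ) ^ 4) * (∑ x : TorusSite 2 L, ∑ y : TorusSite 2 L,
          ∫ θ in cube, ((D x y θ : ℝ) : ℂ) * wt θ).re := by
      rw [show (1 / (L : ℂ) ^ 4) = (((1 / (L : ℝ) ^ 4 : ℝ)) : ℂ) by push_cast; ring, Complex.re_ofReal_mul]
    rw [h4]
    have hL4 : (0 : ℝ) < (L : ℝ) ^ 4 := by positivity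
    have key : (1 / (L : ℝ) ^ 4) * (∑ x : TorusSite 2 L, ∑ y : TorusSite 2 L,
        ∫ θ in cube, ((D x y θ : ℝ) : ℂ) * wt θ).re ≤ κ * Z.re := by
      rw [div_mul_eq_mul_div, one_mul, div_le_iff₀ hL4]
      linarith [hsumre]
    linarith
  -- conclude
  have hZne : Z ≠ 0 := fun h => by rw [h, Complex.zero_re] at hZpos; exact lt_irrefl _ hZpos
  refine ⟨hZne, ?_⟩
  have hZeq : Z = ((Z.re : ℝ) : ℂ) := Complex.ext (by simp) (by simp [hZim])
  rw [hZeq, Complex.div_ofReal_re, le_div_iff₀ hZpos]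
  nlinarith [hZpos, hre_main, hκ]

variable {r : ℕ}

/-- Continuity of a window generating function composed with any site map. [folklore] -/
theorem sg_continuous_genF {Λ : Type*} (c : ((Fin r × Fin r × Fin r) → ℤ) →₀ ℂ)
    (g : (Fin r × Fin r × Fin r) → Λ) :
    Continuous fun θ : Λ → ℝ =>
      c.sum (fun n a => a * cexp (I * ((∑ w, (n w : ℝ) * θ (g w) : ℝ) : ℂ))) := by
  classical
  unfold Finsupp.sum
  refine continuous_finsetSum _ fun n _ => ?_
  refine continuous_const.mul (Complex.continuous_exp.comp (continuous_const.mul ?_))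
  refine Complex.continuous_ofReal.comp ?_
  exact continuous_finsetSum _ fun w _ => continuous_const.mul (continuous_apply _)

/-- Continuity of the complex Gibbs weight `θ ↦ e^{−K Σ_s F(θ∘sh s)}`. [folklore] -/
theorem sg_continuous_weight {Λ : Type*} [Fintype Λ] (K : ℝ) (c : ((Fin r × Fin r × Fin r) → ℤ) →₀ ℂ)
    (sh : Λ → (Fin r × Fin r × Fin r) → Λ) :
    Continuous fun θ : Λ → ℝ => cexp (-((K : ℂ) * ∑ s : Λ,
      c.sum (fun n a => a * cexp (I * ((∑ w, (n w : ℝ) * θ (sh s w) : ℝ) : ℂ))))) := by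
  refine Complex.continuous_exp.comp (Continuous.neg (continuous_const.mul ?_))
  exact continuous_finsetSum _ fun s _ => sg_continuous_genF c (sh s)

/-- Under (C) with `c₀ ≥ 0` and `K ≥ 0` the complex Gibbs weight has modulus `≤ 1`. [folklore] -/
theorem sg_norm_weight_le_one {Λ : Type*} [Fintype Λ] {K c₀ : ℝ} (hK : 0 ≤ K) (hc₀ : 0 ≤ c₀)
    (c : ((Fin r × Fin r × Fin r) → ℤ) →₀ ℂ)
    (hC : ∀ φ : (Fin r × Fin r × Fin r) → ℝ, c₀ * ∑ w, ∑ w', (1 - Real.cos (φ w - φ w')) ≤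
      (c.sum (fun n a => a * cexp (I * ((∑ w, (n w : ℝ) * φ w : ℝ) : ℂ)))).re)
    (sh : Λ → (Fin r × Fin r × Fin r) → Λ) (θ : Λ → ℝ) :
    ‖cexp (-((K : ℂ) * ∑ s : Λ,
      c.sum (fun n a => a * cexp (I * ((∑ w, (n w : ℝ) * θ (sh s w) : ℝ) : ℂ)))))‖ ≤ 1 := by
  rw [Complex.norm_exp]
  apply Real.exp_le_one_iff.mpr
  have hre : ∀ s : Λ, 0 ≤ (c.sum (fun n a => a * cexp (I *
      ((∑ w, (n w : ℝ) * θ (sh s w) : ℝ) : ℂ)))).re := fun s =>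
    le_trans (mul_nonneg hc₀ (Finset.sum_nonneg fun _ _ => Finset.sum_nonneg fun _ _ =>
      sub_nonneg.2 (Real.cos_le_one _))) (hC _)
  have : 0 ≤ ((K : ℂ) * ∑ s : Λ, c.sum (fun n a => a * cexp (I *
      ((∑ w, (n w : ℝ) * θ (sh s w) : ℝ) : ℂ)))).re := by
    simp only [Complex.mul_re, Complex.ofReal_re, Complex.ofReal_im, zero_mul, sub_zero, Complex.re_sum]
    exact mul_nonneg hK (Finset.sum_nonneg fun s _ => hre s)
  simpa using this

/-- **The split glue** `ComplexPositivity → ComplexTwoPointDeficit → BirComplexStableXYR`, all three stated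
STRUCTURALLY (bodies verbatim; the conclusion is the body of `BalabanIR.BirComplexStableXYR`, rev 11, so that
`example : BirComplexStableXYR := birComplexStableXYR_of_positivity_of_deficit h1 h2` in a file importing the
Theses).  Thresholds `K₀ = max (max K₀¹ K₀²) (max (2C/c₀) 1)`, `L₀ = max L₀¹ L₀²`. [folklore] -/
theorem birComplexStableXYR_of_positivity_of_deficit
    (h1 : ∀ (r : ℕ) (B c₀ : ℝ), 2 ≤ r → 0 < c₀ → ∃ K₀ : ℝ, ∃ L₀ : ℕ, ∀ K : ℝ, K₀ ≤ K → ∀ c : ((Fin r × Fin r × Fin r) → ℤ) →₀ ℂ, (∀ n ∈ c.support, ∑ w, n w = 0) → c.sum (fun _ a => a) = 0 → c.sum (fun n a => ‖a‖ * Real.exp (∑ w, |(n w : ℝ)|)) ≤ B → (∀ φ : (Fin r × Fin r × Fin r) → ℝ, c₀ * ∑ w, ∑ w', (1 - Real.cos (φ w - φ w')) ≤ ((fun (φ : (Fin r × Fin r × Fin r) → ℝ) => c.sum (fun n a => a * Complex.exp (Complex.I * ((∑ w, (n w : ℝ) * φ w : ℝ) : ℂ)))) φ).re) → (∀ n : (Fin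 r × Fin r × Fin r) → ℤ, c (fun w => n (w.1, w.2.1, Fin.rev w.2.2)) = (starRingEnd ℂ) (c (-n))) → (∀ n : (Fin r × Fin r × Fin r) → ℤ, c (fun w => n (Fin.rev w.1, Fin.rev w.2.1, w.2.2)) = c n) → ∀ (L M : ℕ) [NeZero L] [NeZero M], L₀ ≤ L → L ≤ M → Even L → Even M → let sh : (Literature.Probability.LatticeModels.TorusSite 2 L × ZMod M) → (Fin r × Fin r × Fin r) → (Literature.Probability.LatticeModels.TorusSite 2 L × ZMod M) := fun s w => (s.1 + ![((w.1 : ℕ) : ZMod L), ((w.2.1 : ℕ) : ZMod L)], s.2 + ((w.2.2 : ℕ) : ZMod M)); let F : ((Fin r × Fin r × Fin r) → ℝ) → ℂ := fun (φ : (Fin r × Fin r × Fin r) → ℝ) => c.sum (fun n a => a * Complex.exp (Complex.I * ((∑ w, (n w : ℝ) * φ w : ℝ) : ℂ))); let A : ((Literature.Probability.LatticeModels.TorusSite 2 L × ZMod M) → ℝ) → ℂ := fun θ => (K : ℂ) * ∑ s : (Literature.Probability.LatticeModels.TorusSite 2 L × ZMod M), F (fun w => θ (sh s w)); let cube : Set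 ((Literature.Probability.LatticeModels.TorusSite 2 L × ZMod M) → ℝ) := Set.pi Set.univ (fun _ => Set.Icc (0:ℝ) (2 * Real.pi)); let Z : ℂ := MeasureTheory.integral (MeasureTheory.volume.restrict cube) (fun θ => Complex.exp (-(A θ))); 0 < Z.re ∧ Z.im = 0)
    (h2 : ∀ (r : ℕ) (B c₀ : ℝ), 2 ≤ r → 0 < c₀ → ∃ K₀ : ℝ, ∃ L₀ : ℕ, ∃ C : ℝ, ∀ K : ℝ, K₀ ≤ K → ∀ c : ((Fin r × Fin r × Fin r) → ℤ) →₀ ℂ, (∀ n ∈ c.support, ∑ w, n w = 0) → c.sum (fun _ a => a) = 0 → c.sum (fun n a => ‖a‖ * Real.exp (∑ w, |(n w : ℝ)|)) ≤ B → (∀ φ : (Fin r × Fin r × Fin r) → ℝ, c₀ * ∑ w, ∑ w', (1 - Real.cos (φ w - φ w')) ≤ ((fun (φ : (Fin r × Fin r × Fin r) → ℝ) => c.sum (fun n a => a * Complex.exp (Complex.I * ((∑ w, (n w : ℝ) * φ w : ℝ) : ℂ)))) φ).re) → (∀ n : (Fin r × Fin r × Fin r) → ℤ, c (fun w => n (w.1,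 w.2.1, Fin.rev w.2.2)) = (starRingEnd ℂ) (c (-n))) → (∀ n : (Fin r × Fin r × Fin r) → ℤ, c (fun w => n (Fin.rev w.1, Fin.rev w.2.1, w.2.2)) = c n) → ∀ (L M : ℕ) [NeZero L] [NeZero M], L₀ ≤ L → L ≤ M → Even L → Even M → let sh : (Literature.Probability.LatticeModels.TorusSite 2 L × ZMod M) → (Fin r × Fin r × Fin r) → (Literature.Probability.LatticeModels.TorusSite 2 L × ZMod M) := fun s w => (s.1 + ![((w.1 : ℕ) : ZMod L), ((w.2.1 : ℕ) : ZMod L)], s.2 + ((w.2.2 : ℕ) : ZMod M)); let F : ((Fin r × Fin r × Fin r) → ℝ) → ℂ := fun (φ : (Fin r × Fin r × Fin r) → ℝ) => c.sum (fun n a => a * Complex.exp (Complex.I * ((∑ w, (n w : ℝ) * φ w : ℝ) : ℂ))); let A : ((Literature.Probability.LatticeModels.TorusSite 2 L × ZMod M) → ℝ) → ℂ := fun θ => (K : ℂ) * ∑ s : (Literature.Probability.LatticeModels.TorusSite 2 L × ZMod M), F (fun w => θ (sh s w)); let cube : Set ((Literature.Probability.LatticeModels.TorusSite 2 L × ZMod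 M) → ℝ) := Set.pi Set.univ (fun _ => Set.Icc (0:ℝ) (2 * Real.pi)); let Z : ℂ := MeasureTheory.integral (MeasureTheory.volume.restrict cube) (fun θ => Complex.exp (-(A θ))); ∀ x y : Literature.Probability.LatticeModels.TorusSite 2 L, (MeasureTheory.integral (MeasureTheory.volume.restrict cube) (fun θ => (((1 - Real.cos (θ (x, 0) - θ (y, 0)) : ℝ)) : ℂ) * Complex.exp (-(A θ)))).re ≤ C / (c₀ * K) * Z.re) :
    ∀ (r : ℕ) (B c₀ : ℝ), 2 ≤ r → 0 < c₀ → ∃ K₀ : ℝ, ∃ L₀ : ℕ, ∀ K : ℝ, K₀ ≤ K → ∀ c : ((Fin r × Fin r × Fin r) → ℤ) →₀ ℂ, (∀ n ∈ c.support, ∑ w, n w = 0) → c.sum (fun _ a => a) = 0 → c.sum (fun n a => ‖a‖ * Real.exp (∑ w, |(n w : ℝ)|)) ≤ B → (∀ φ : (Fin r × Fin r × Fin r) → ℝ, c₀ * ∑ w, ∑ w', (1 - Real.cos (φ w - φ w')) ≤ ((fun (φ : (Fin r × Fin r × Fin r) → ℝ) => c.sum (fun n a => a * Complex.exp (Complex.I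 * ((∑ w, (n w : ℝ) * φ w : ℝ) : ℂ)))) φ).re) → (∀ n : (Fin r × Fin r × Fin r) → ℤ, c (fun w => n (w.1, w.2.1, Fin.rev w.2.2)) = (starRingEnd ℂ) (c (-n))) → (∀ n : (Fin r × Fin r × Fin r) → ℤ, c (fun w => n (Fin.rev w.1, Fin.rev w.2.1, w.2.2)) = c n) → ∀ (L M : ℕ) [NeZero L] [NeZero M], L₀ ≤ L → L ≤ M → Even L → Even M → let sh : (Literature.Probability.LatticeModels.TorusSite 2 L × ZMod M) → (Fin r × Fin r × Fin r) → (Literature.Probability.LatticeModels.TorusSite 2 L × ZMod M) := fun s w => (s.1 + ![((w.1 : ℕ) : ZMod L), ((w.2.1 : ℕ) : ZMod L)], s.2 + ((w.2.2 : ℕ) : ZMod M)); let F : ((Fin r × Fin r × Fin r) → ℝ) → ℂ := fun (φ : (Fin r × Fin r × Fin r) → ℝ) => c.sum (fun n a => a * Complex.exp (Complex.I * ((∑ w, (n w : ℝ) * φ w : ℝ) : ℂ))); let A : ((Literature.Probability.LatticeModels.TorusSite 2 L × ZMod M) → ℝ) → ℂ := fun θ => (K : ℂ) * ∑ s : (Literature.Probability.LatticeModels.TorusSite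 2 L × ZMod M), F (fun w => θ (sh s w)); let cube : Set ((Literature.Probability.LatticeModels.TorusSite 2 L × ZMod M) → ℝ) := Set.pi Set.univ (fun _ => Set.Icc (0:ℝ) (2 * Real.pi)); let Z : ℂ := MeasureTheory.integral (MeasureTheory.volume.restrict cube) (fun θ => Complex.exp (-(A θ))); let O : ((Literature.Probability.LatticeModels.TorusSite 2 L × ZMod M) → ℝ) → ℝ := fun θ => ‖∑ x : Literature.Probability.LatticeModels.TorusSite 2 L, Complex.exp (Complex.I * (θ (x, 0) : ℂ))‖ ^ 2 / (L : ℝ) ^ 4; Z ≠ 0 ∧ (1/2 : ℝ) ≤ ((MeasureTheory.integral (MeasureTheory.volume.restrict cube) (fun θ => (O θ : ℂ) * Complex.exp (-(A θ)))) / Z).re := by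
  intro r B c₀ hr hc₀
  obtain ⟨K₅, L₅, H5⟩ := h1 r B c₀ hr hc₀
  obtain ⟨K₆, L₆, C, H6⟩ := h2 r B c₀ hr hc₀
  refine ⟨max (max K₅ K₆) (max (2 * (C / c₀)) 1), max L₅ L₆, ?_⟩
  intro K hK c hU1 hN hA hC hR hP L M _ _ hL0 hLM hLe hMe
  have hK5 : K₅ ≤ K := le_trans (le_trans (le_max_left _ _) (le_max_left _ _)) hK
  have hK6 : K₆ ≤ K := le_trans (le_trans (le_max_right _ _) (le_max_left _ _)) hK
  have hK1 : 1 ≤ K := le_trans (le_trans (le_max_right _ _) (le_max_right _ _)) hK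
  have hK2 : 2 * (C / c₀) ≤ K := le_trans (le_trans (le_max_left _ _) (le_max_right _ _)) hK
  have hK0 : 0 ≤ K := by linarith
  have hL5 : L₅ ≤ L := le_trans (le_max_left _ _) hL0
  have hL6 : L₆ ≤ L := le_trans (le_max_right _ _) hL0
  have p5 := H5 K hK5 c hU1 hN hA hC hR hP L M hL5 hLM hLe hMe
  have p6 := H6 K hK6 c hU1 hN hA hC hR hP L M hL6 hLM hLe hMe
  dsimp only at p5 p6 hC ⊢
  -- `κ := C/(c₀K) ≤ 1/2`
  have hκ : C / (c₀ * K) ≤ 1 / 2 := by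
    rcases le_or_gt C 0 with hC0 | hC0
    · have : C / (c₀ * K) ≤ 0 := div_nonpos_of_nonpos_of_nonneg hC0 (by positivity)
      linarith
    · have hcK : 0 < c₀ * K := by
        have : 0 < C / c₀ := div_pos hC0 hc₀
        nlinarith
      rw [div_le_iff₀ hcK]
      have : C / c₀ * c₀ = C := div_mul_cancel₀ C hc₀.ne'
      nlinarith
  exact sg_core L M _ (sg_continuous_weight K c _) (sg_norm_weight_le_one hK0 hc₀.le c hC _) hκ
    p5.1 p5.2 p6

end SplitGlue

end Summit.HubbardSuperconductivity.HubbardSuperconductivity.Theorems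

end
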